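import Literature.Algebra.Module.DivisibleTorsionPointCount
import Mathlib.RingTheory.DedekindDomain.Ideal.Lemmas
import HarnessLib

/-!
# Multiplicativity of the torsion count of a divisible group with `𝒪`-action: `|M[IJ]| = |M[I]| · |M[J]|`
# ([GortzWedhorn2023] Prop. 27.188 (2) ∕ Prop. 27.190; [AtiyahMacdonald1969] Prop. 1.10 (Chinese remainder); [MumfordAV1970] §6 App. 3)

Topic `Literature/Algebra/Module`; namespace `Literature.Algebra.Module.DivisibleTorsionMultiplicativity` (sequel of ★ `DivisibleTorsionPointCount`, same
multiplicative currency `φ : 𝒪 → M → M`, `M[𝔞] = {x ∣ φ(r) x = 1 ∀ r ∈ 𝔞}`).  THEOREMS ONLY (no definition, no named fact, no `instance`, no notation, no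
`sorry`).  Cell `hodgecm-mathlib` (D-0151), P6 «MOD» (crux hLiu418 = stmt-HodgeConjecture-24832, `--supports`, count-neutral): line L3 (`stub_FROB`), ROOF road,
(ρ-𝔟) engine re-wire, LA3-plan RULING #3 head **H4 ∕ (M1) «DIVISIBLE MULTIPLICATIVITY»** (LA3-p03 (g2) census): the Lagrangian count
`hcard : #K · #K′ = n^{2g}` of the non-Lagrangian quotient-dual engine reads, for `K = A[𝔟](κ̄)`, `K′ ≃ A[𝔠](κ̄)` with `𝔟 · 𝔠 = (n)`, the identity
`#A[𝔟](κ̄) · #A[𝔠](κ̄) = #A[(n)](κ̄) = #A[n](κ̄) = n^{2g}`; everything but the first equality is ★ (`Motives.AbelianVariety.natCard_torsionPoints_eq_of_isAlgClosed`).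
This file proves the first equality as PURE ALGEBRA: for a group `M` with an additive, multiplicative, unital family of endomorphisms `φ : 𝒪 → End M` over a
DEDEKIND domain `𝒪` such that every `φ(r)`, `r ≠ 0`, is SURJECTIVE (the isogenies `ι(r)` of an abelian variety on points over an algebraically closed field),
**`|M[I · J]| = |M[I]| · |M[J]|` for all nonzero ideals `I`, `J`** (as `Nat.card`, no finiteness assumed).  Also the `Subgroup`-costume of ★ `torsion_antitone`
(head H1 «monotonicity»: `𝔞 ≤ 𝔟 → M[𝔟] ≤ M[𝔞]`).  HC_CM is proved only modulo the printed citations until rung 0 closes; this file is generic, changes no count.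

THE MATHEMATICS.  (CRT, any commutative `𝒪`, any `M`) If `I + J = 𝒪`, `1 = i + j`, then every `x ∈ M[IJ]` is `x = φ(j)x · φ(i)x` with `φ(j)x ∈ M[I]`,
`φ(i)x ∈ M[J]`, and `M[I] ∩ M[J] = M[I + J] = M[𝒪] = 1` (★ `torsion_sup`, `torsion_top`); so `(y, z) ↦ yz : M[I] × M[J] → M[IJ]` is a bijection and
`|M[IJ]| = |M[I]|·|M[J]|` ([AtiyahMacdonald1969] Prop. 1.10).  (Dedekind, divisible) `|M[𝔮^j]| = |M[𝔮]|^j` for a maximal `𝔮 ≠ 0` (★ `natCard_torsion_pow` with a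
uniformiser `ϖ ∈ 𝔮 ∖ 𝔮²`, ★ `exists_uniformizer_laws`); writing `I = 𝔮^a · Q` with `𝔮 + Q = 𝒪` (Mathlib `Ideal.eq_prime_pow_mul_coprime`) gives
`|M[I𝔮]| = |M[𝔮]|^{a+1}|M[Q]| = |M[I]|·|M[𝔮]|`, and induction on the prime factorisation of `J` gives the head.

* §0 `subgroup_antitone_of_coe_eq` (H1 in `Subgroup` costume over ★ `exists_subgroup_coe_eq`).
* §1 (any `𝒪`) `map_one_of_mul` (`φ(r)1 = 1`), `torsion_mul_left_of_mem` ∕ `torsion_mul_right_of_mem` (the two CRT projections), `exists_mul_eq_of_sup_eq_top`,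
  `eq_one_of_torsion_of_sup_eq_top`, **`natCard_torsion_mul_of_sup_eq_top`**; `torsion_span_singleton_iff` (`M[(a)] = Ker φ(a)`), `natCard_torsion_span_singleton`.
* §2 (`𝒪` Dedekind, all `φ(r)`, `r ≠ 0`, surjective) `natCard_torsion_prime_pow`, `natCard_torsion_mul_prime`, **`natCard_torsion_mul`**, and the hcard shape
  **`natCard_torsion_mul_natCard_torsion_of_mul_eq_span`** (`I · J = (a)` ⇒ `|M[I]| · |M[J]| = |{x ∣ φ(a)x = 1}|`).

## References
* [GortzWedhorn2023] U. Görtz, T. Wedhorn, *Algebraic Geometry II* (2023) — Prop. 27.188 (2), Def. 27.189, Prop. 27.190.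
* [AtiyahMacdonald1969] M. F. Atiyah, I. G. Macdonald, *Introduction to Commutative Algebra* (1969) — Prop. 1.10 (p. 7), Ch. 9 (Dedekind domains).
* [MumfordAV1970] D. Mumford, *Abelian Varieties* (1970) — §6 Application 3 (p. 64) (`#A[n](k̄) = n^{2g}`, isogenies surjective on points).
-/

set_option autoImplicit false

namespace Literature.Algebra.Module.DivisibleTorsionMultiplicativity

open Literature.Algebra.Module.DivisibleTorsionPointCount

variable {M : Type*} [Group M] {O : Type*} [CommRing O]

/-! ## §0 H1: monotonicity in `Subgroup` costume -/

/-- **H1 «MONOTONICITY» in `Subgroup` costume**: if `S`, `T` are the subgroups with carriers `M[𝔞]`, `M[𝔟]` (★ `exists_subgroup_coe_eq`) and `𝔞 ≤ 𝔟`, then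
`T ≤ S` (`M[𝔟] ⊆ M[𝔞]`, ★ `torsion_antitone`). [cite: GortzWedhorn2023, Prop. 27.188 (2)] -/
theorem subgroup_antitone_of_coe_eq (φ : O → M → M) {𝔞 𝔟 : Ideal O} (h : 𝔞 ≤ 𝔟) {S T : Subgroup M}
    (hS : (S : Set M) = {x | ∀ r ∈ 𝔞, φ r x = 1}) (hT : (T : Set M) = {x | ∀ r ∈ 𝔟, φ r x = 1}) : T ≤ S := by
  intro x hx
  rw [← SetLike.mem_coe, hS]
  rw [← SetLike.mem_coe, hT] at hx
  exact torsion_antitone φ h hx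

/-! ## §1 The Chinese remainder theorem for torsion: `M[IJ] = M[I] · M[J]`, `M[I] ∩ M[J] = 1` for `I + J = 𝒪` -/

omit [CommRing O] in
/-- `φ(r) 1 = 1` for a multiplicative family. [cite: GortzWedhorn2023, Prop. 27.188 (2)] -/
theorem map_one_of_mul (φ : O → M → M) (hmul : ∀ r x y, φ r (x * y) = φ r x * φ r y) (r : O) : φ r 1 = 1 := by
  have h := hmul r 1 1
  rw [one_mul] at h
  exact left_eq_mul.mp h

/-- For `x ∈ M[IJ]` and `j ∈ J`: `φ(j)x ∈ M[I]` (`r·j ∈ IJ` for `r ∈ I`). [cite: AtiyahMacdonald1969, Prop. 1.10 (p. 7)] -/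
theorem torsion_mul_left_of_mem (φ : O → M → M) (hcomp : ∀ r s x, φ (r * s) x = φ r (φ s x)) {I J : Ideal O} {x : M}
    (hx : ∀ r ∈ I * J, φ r x = 1) {j : O} (hj : j ∈ J) : ∀ r ∈ I, φ r (φ j x) = 1 := fun r hr => by
  rw [← hcomp]
  exact hx _ (Ideal.mul_mem_mul hr hj)

/-- For `x ∈ M[IJ]` and `i ∈ I`: `φ(i)x ∈ M[J]`. [cite: AtiyahMacdonald1969, Prop. 1.10 (p. 7)] -/
theorem torsion_mul_right_of_mem (φ : O → M → M) (hcomp : ∀ r s x, φ (r * s) x = φ r (φ s x)) {I J : Ideal O} {x : M}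
    (hx : ∀ r ∈ I * J, φ r x = 1) {i : O} (hi : i ∈ I) : ∀ r ∈ J, φ r (φ i x) = 1 := fun r hr => by
  have h : r * i ∈ I * J := by
    rw [mul_comm r i]
    exact Ideal.mul_mem_mul hi hr
  rw [← hcomp]
  exact hx _ h

/-- **CRT, existence**: for `I + J = 𝒪` every `x ∈ M[IJ]` is a product `y · z` with `y ∈ M[I]`, `z ∈ M[J]` (`1 = i + j`, `y = φ(j)x`, `z = φ(i)x`).
[cite: AtiyahMacdonald1969, Prop. 1.10 (p. 7)] -/
theorem exists_mul_eq_of_sup_eq_top (φ : O → M → M) (hadd : ∀ r s x, φ (r + s) x = φ r x * φ s x)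
    (hcomp : ∀ r s x, φ (r * s) x = φ r (φ s x)) (hone : ∀ x, φ 1 x = x) {I J : Ideal O} (hIJ : I ⊔ J = ⊤) {x : M}
    (hx : ∀ r ∈ I * J, φ r x = 1) : ∃ y z : M, (∀ r ∈ I, φ r y = 1) ∧ (∀ r ∈ J, φ r z = 1) ∧ y * z = x := by
  obtain ⟨i, hi, j, hj, hij⟩ := Submodule.mem_sup.mp ((Ideal.eq_top_iff_one _).mp hIJ)
  refine ⟨φ j x, φ i x, torsion_mul_left_of_mem φ hcomp hx hj, torsion_mul_right_of_mem φ hcomp hx hi, ?_⟩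
  rw [← hadd, add_comm, hij, hone]

/-- **CRT, uniqueness**: for `I + J = 𝒪`, `M[I] ∩ M[J] = 1`. [cite: AtiyahMacdonald1969, Prop. 1.10 (p. 7)] -/
theorem eq_one_of_torsion_of_sup_eq_top (φ : O → M → M) (hmul : ∀ r x y, φ r (x * y) = φ r x * φ r y)
    (hadd : ∀ r s x, φ (r + s) x = φ r x * φ s x) (hone : ∀ x, φ 1 x = x) {I J : Ideal O} (hIJ : I ⊔ J = ⊤) {x : M}
    (hxI : ∀ r ∈ I, φ r x = 1) (hxJ : ∀ r ∈ J, φ r x = 1) : x = 1 := by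
  have hx : x ∈ {x : M | ∀ r ∈ I, φ r x = 1} ∩ {x | ∀ r ∈ J, φ r x = 1} := ⟨hxI, hxJ⟩
  rw [torsion_sup φ hmul hadd I J, hIJ, torsion_top φ hmul hone] at hx
  exact hx

/-- **CRT, count: `|M[IJ]| = |M[I]| · |M[J]|` for `I + J = 𝒪`** (`(y, z) ↦ yz` is a bijection `M[I] × M[J] ≃ M[IJ]`; as `Nat.card`, no finiteness).
[cite: AtiyahMacdonald1969, Prop. 1.10 (p. 7)] -/
theorem natCard_torsion_mul_of_sup_eq_top (φ : O → M → M) (hmul : ∀ r x y, φ r (x * y) = φ r x * φ r y)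
    (hadd : ∀ r s x, φ (r + s) x = φ r x * φ s x) (hcomp : ∀ r s x, φ (r * s) x = φ r (φ s x)) (hone : ∀ x, φ 1 x = x)
    {I J : Ideal O} (hIJ : I ⊔ J = ⊤) :
    Nat.card {x : M // ∀ r ∈ I * J, φ r x = 1} =
      Nat.card {x : M // ∀ r ∈ I, φ r x = 1} * Nat.card {x : M // ∀ r ∈ J, φ r x = 1} := by
  obtain ⟨SI, hSI⟩ := exists_subgroup_coe_eq φ hmul I
  obtain ⟨SJ, hSJ⟩ := exists_subgroup_coe_eq φ hmul J
  have memI : ∀ x, x ∈ SI ↔ ∀ r ∈ I, φ r x = 1 := fun x => by rw [← SetLike.mem_coe, hSI]; rfl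
  have memJ : ∀ x, x ∈ SJ ↔ ∀ r ∈ J, φ r x = 1 := fun x => by rw [← SetLike.mem_coe, hSJ]; rfl
  -- the product map
  let f : {x : M // ∀ r ∈ I, φ r x = 1} × {x : M // ∀ r ∈ J, φ r x = 1} → {x : M // ∀ r ∈ I * J, φ r x = 1} :=
    fun p => ⟨p.1.1 * p.2.1, fun r hr => by
      rw [hmul, p.1.2 r (Ideal.mul_le_right hr), p.2.2 r (Ideal.mul_le_left hr), one_mul]⟩
  have hf : Function.Bijective f := by
    constructor
    · rintro ⟨⟨y, hy⟩, ⟨z, hz⟩⟩ ⟨⟨y', hy'⟩, ⟨z', hz'⟩⟩ h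
      have h' : y * z = y' * z' := congrArg Subtype.val h
      -- `w := y'⁻¹ y = z' z⁻¹ ∈ M[I] ∩ M[J] = 1`
      have hwI : y'⁻¹ * y ∈ SI := SI.mul_mem (SI.inv_mem ((memI y').mpr hy')) ((memI y).mpr hy)
      have hw : y'⁻¹ * y = z' * z⁻¹ := by
        rw [inv_mul_eq_iff_eq_mul, ← mul_assoc, eq_mul_inv_iff_mul_eq, h']
      have hwJ : y'⁻¹ * y ∈ SJ := by
        rw [hw]
        exact SJ.mul_mem ((memJ z').mpr hz') (SJ.inv_mem ((memJ z).mpr hz))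
      have hw1 : y'⁻¹ * y = 1 :=
        eq_one_of_torsion_of_sup_eq_top φ hmul hadd hone hIJ ((memI _).mp hwI) ((memJ _).mp hwJ)
      have hy_eq : y = y' := by
        rw [inv_mul_eq_one] at hw1
        exact hw1.symm
      subst hy_eq
      have hz_eq : z = z' := mul_left_cancel h'
      subst hz_eq
      rfl
    · rintro ⟨x, hx⟩
      obtain ⟨y, z, hy, hz, hyz⟩ := exists_mul_eq_of_sup_eq_top φ hadd hcomp hone hIJ hx
      exact ⟨⟨⟨y, hy⟩, ⟨z, hz⟩⟩, Subtype.ext hyz⟩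
  rw [← Nat.card_congr (Equiv.ofBijective f hf), Nat.card_prod]

/-- `M[(a)] = Ker φ(a)`: `x` is killed by the principal ideal `(a)` iff `φ(a) x = 1`. [cite: GortzWedhorn2023, Prop. 27.188 (2)] -/
theorem torsion_span_singleton_iff (φ : O → M → M) (hmul : ∀ r x y, φ r (x * y) = φ r x * φ r y)
    (hcomp : ∀ r s x, φ (r * s) x = φ r (φ s x)) (a : O) (x : M) : (∀ r ∈ Ideal.span {a}, φ r x = 1) ↔ φ a x = 1 := by
  refine ⟨fun h => h a (Ideal.mem_span_singleton_self a), fun h r hr => ?_⟩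
  obtain ⟨s, rfl⟩ := Ideal.mem_span_singleton'.mp hr
  rw [hcomp, h, map_one_of_mul φ hmul]

/-- `|M[(a)]| = |{x ∣ φ(a) x = 1}|`. [cite: GortzWedhorn2023, Prop. 27.188 (2)] -/
theorem natCard_torsion_span_singleton (φ : O → M → M) (hmul : ∀ r x y, φ r (x * y) = φ r x * φ r y)
    (hcomp : ∀ r s x, φ (r * s) x = φ r (φ s x)) (a : O) :
    Nat.card {x : M // ∀ r ∈ Ideal.span {a}, φ r x = 1} = Nat.card {x : M // φ a x = 1} :=
  Nat.card_congr (Equiv.subtypeEquivRight fun x => torsion_span_singleton_iff φ hmul hcomp a x)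

/-! ## §2 Dedekind domain, all `φ(r)` (`r ≠ 0`) surjective: `|M[𝔮^j]| = |M[𝔮]|^j`, `|M[I𝔮]| = |M[I]|·|M[𝔮]|`, `|M[IJ]| = |M[I]|·|M[J]|` -/

section Dedekind

variable [IsDedekindDomain O] (φ : O → M → M) (hmul : ∀ r x y, φ r (x * y) = φ r x * φ r y) (hadd : ∀ r s x, φ (r + s) x = φ r x * φ s x)
  (hcomp : ∀ r s x, φ (r * s) x = φ r (φ s x)) (hone : ∀ x, φ 1 x = x) (hsurj : ∀ r : O, r ≠ 0 → Function.Surjective (φ r))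
include hmul hadd hcomp hone hsurj

/-- **`|M[𝔮^j]| = |M[𝔮]|^j`** for a maximal `𝔮 ≠ 0` of a Dedekind domain, all `φ(r)` (`r ≠ 0`) surjective (★ `natCard_torsion_pow` with a uniformiser
`ϖ ∈ 𝔮 ∖ 𝔮²`). [cite: GortzWedhorn2023, Prop. 27.188 (2) and Def. 27.189] -/
theorem natCard_torsion_prime_pow (𝔮 : Ideal O) [𝔮.IsMaximal] (h𝔮 : 𝔮 ≠ ⊥) (j : ℕ) :
    Nat.card {x : M // ∀ r ∈ 𝔮 ^ j, φ r x = 1} = Nat.card {x : M // ∀ r ∈ 𝔮, φ r x = 1} ^ j := by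
  obtain ⟨ϖ, hϖ, hϖ2⟩ := exists_mem_not_mem_sq 𝔮 h𝔮 Ideal.IsPrime.ne_top'
  have hϖ0 : ϖ ≠ 0 := by
    rintro rfl
    exact hϖ2 (Ideal.zero_mem _)
  exact natCard_torsion_pow φ hmul hadd hcomp hone 𝔮 ϖ hϖ (fun i => (exists_uniformizer_laws 𝔮 ϖ hϖ hϖ2 i).1)
    (fun i => (exists_uniformizer_laws 𝔮 ϖ hϖ hϖ2 i).2) (hsurj ϖ hϖ0) j

/-- **`|M[I·𝔮]| = |M[I]| · |M[𝔮]|`** for `I ≠ 0` and a maximal `𝔮 ≠ 0`: `I = 𝔮^a · Q` with `𝔮 + Q = 𝒪` (Mathlib `Ideal.eq_prime_pow_mul_coprime`), CRT and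
`|M[𝔮^{a+1}]| = |M[𝔮]|·|M[𝔮^a]|`. [cite: GortzWedhorn2023, Prop. 27.188 (2) and Prop. 27.190] -/
theorem natCard_torsion_mul_prime (I : Ideal O) (hI : I ≠ ⊥) (𝔮 : Ideal O) [𝔮.IsMaximal] (h𝔮 : 𝔮 ≠ ⊥) :
    Nat.card {x : M // ∀ r ∈ I * 𝔮, φ r x = 1} = Nat.card {x : M // ∀ r ∈ I, φ r x = 1} * Nat.card {x : M // ∀ r ∈ 𝔮, φ r x = 1} := by
  obtain ⟨Q, hQ, hIeq⟩ := Ideal.eq_prime_pow_mul_coprime hI 𝔮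
  set a := Multiset.count 𝔮 (UniqueFactorizationMonoid.normalizedFactors I) with ha
  have hcop : ∀ k : ℕ, 𝔮 ^ k ⊔ Q = ⊤ := fun k => Ideal.pow_sup_eq_top hQ
  have h1 : I * 𝔮 = 𝔮 ^ (a + 1) * Q := by rw [hIeq, pow_succ]; ring
  rw [h1, natCard_torsion_mul_of_sup_eq_top φ hmul hadd hcomp hone (hcop (a + 1)),
    natCard_torsion_prime_pow φ hmul hadd hcomp hone hsurj 𝔮 h𝔮 (a + 1), pow_succ]
  conv_rhs => rw [hIeq, natCard_torsion_mul_of_sup_eq_top φ hmul hadd hcomp hone (hcop a),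
    natCard_torsion_prime_pow φ hmul hadd hcomp hone hsurj 𝔮 h𝔮 a]
  ring

/-- **DIVISIBLE MULTIPLICATIVITY `|M[I · J]| = |M[I]| · |M[J]|`** for all nonzero ideals `I`, `J` of a Dedekind domain `𝒪` acting on a group `M` through an
additive multiplicative unital family `φ` with every `φ(r)`, `r ≠ 0`, surjective (induction on the prime factorisation of `J`).
[cite: GortzWedhorn2023, Prop. 27.188 (2) and Prop. 27.190] -/
theorem natCard_torsion_mul (I J : Ideal O) (hI : I ≠ ⊥) (hJ : J ≠ ⊥) :
    Nat.card {x : M // ∀ r ∈ I * J, φ r x = 1} = Nat.card {x : M // ∀ r ∈ I, φ r x = 1} * Nat.card {x : M // ∀ r ∈ J, φ r x = 1} := by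
  revert hJ
  refine UniqueFactorizationMonoid.induction_on_prime J ?_ ?_ ?_
  · intro h
    exact absurd rfl h
  · intro u hu _
    have hu' : u = ⊤ := Ideal.isUnit_iff.mp hu
    subst hu'
    have htop : Nat.card {x : M // ∀ r ∈ (⊤ : Ideal O), φ r x = 1} = 1 := by
      have e : {x : M // ∀ r ∈ (⊤ : Ideal O), φ r x = 1} ≃ (({1} : Set M) : Type _) := Equiv.setCongr (torsion_top φ hmul hone)
      rw [Nat.card_congr e, Nat.card_unique]
    rw [Ideal.mul_top, htop, mul_one]
  · intro J q hJ0 hq ih _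
    haveI : q.IsMaximal := (Ideal.isPrime_of_prime hq).isMaximal hq.ne_zero
    have hq0 : q ≠ ⊥ := hq.ne_zero
    have hIJ : I * J ≠ ⊥ := mul_ne_zero hI hJ0
    calc Nat.card {x : M // ∀ r ∈ I * (q * J), φ r x = 1}
        = Nat.card {x : M // ∀ r ∈ (I * J) * q, φ r x = 1} := by rw [show I * (q * J) = (I * J) * q by ring]
      _ = Nat.card {x : M // ∀ r ∈ I * J, φ r x = 1} * Nat.card {x : M // ∀ r ∈ q, φ r x = 1} :=
          natCard_torsion_mul_prime φ hmul hadd hcomp hone hsurj (I * J) hIJ q hq0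
      _ = Nat.card {x : M // ∀ r ∈ I, φ r x = 1} * (Nat.card {x : M // ∀ r ∈ J, φ r x = 1} * Nat.card {x : M // ∀ r ∈ q, φ r x = 1}) := by
          rw [ih hJ0, mul_assoc]
      _ = Nat.card {x : M // ∀ r ∈ I, φ r x = 1} * Nat.card {x : M // ∀ r ∈ q * J, φ r x = 1} := by
          rw [show q * J = J * q by ring, natCard_torsion_mul_prime φ hmul hadd hcomp hone hsurj J hJ0 q hq0]

/-- **THE hcard SHAPE: `I · J = (a)` ⇒ `|M[I]| · |M[J]| = |{x ∣ φ(a) x = 1}|`** (e.g. `𝔟 · 𝔠 = (n)`: `#A[𝔟] · #A[𝔠] = #A[n]`).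
[cite: GortzWedhorn2023, Prop. 27.188 (2) and Prop. 27.190] -/
theorem natCard_torsion_mul_natCard_torsion_of_mul_eq_span {I J : Ideal O} (hI : I ≠ ⊥) (hJ : J ≠ ⊥) {a : O}
    (h : I * J = Ideal.span {a}) :
    Nat.card {x : M // ∀ r ∈ I, φ r x = 1} * Nat.card {x : M // ∀ r ∈ J, φ r x = 1} = Nat.card {x : M // φ a x = 1} := by
  rw [← natCard_torsion_mul φ hmul hadd hcomp hone hsurj I J hI hJ, h, natCard_torsion_span_singleton φ hmul hcomp a]

/-- `|M[I]|` divides `|{x ∣ φ(a)x = 1}|` whenever `a ∈ I`, `a ≠ 0` (`(a) = I · J`). [cite: GortzWedhorn2023, Prop. 27.190] -/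
theorem natCard_torsion_dvd_of_mem {I : Ideal O} (hI : I ≠ ⊥) {a : O} (ha : a ∈ I) (ha0 : a ≠ 0) :
    Nat.card {x : M // ∀ r ∈ I, φ r x = 1} ∣ Nat.card {x : M // φ a x = 1} := by
  obtain ⟨J, hJ⟩ := Ideal.dvd_iff_le.mpr ((Ideal.span_singleton_le_iff_mem _).mpr ha)
  have hJ0 : J ≠ ⊥ := by
    rintro rfl
    rw [Ideal.mul_bot, Ideal.span_singleton_eq_bot] at hJ
    exact ha0 hJ
  rw [← natCard_torsion_mul_natCard_torsion_of_mul_eq_span φ hmul hadd hcomp hone hsurj hI hJ0 hJ.symm]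
  exact dvd_mul_right _ _

end Dedekind

end Literature.Algebra.Module.DivisibleTorsionMultiplicativity
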